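import Summits.PneNP.PneNP.Theorems.EfNotPOptimalEFProofSearchOfCollapseChecker
import Summits.PneNP.PneNP.Theorems.EfNotPOptimalEFProofSearchOfCollapseRenaming
import Literature.Computability.Complexity.SearchToDecision
import Literature.Computability.Complexity.CookBridges
import Summits.PneNP.PneNP.Theses.EfNotPOptimal
import HarnessLib

/-!
# EF proof search under `P = NP`: the route item `EFProofSearchOfCollapse` (stmt-PneNP-18943)

File 5/5, the closer. `complete_chkFn`: by the normal form (file II) every tautology with an
extended-Frege proof of size `≤ p(|φ|)` has an accepted certificate of length
`≤ 100 (L + p(L) + 1)²`, `L = |encode φ|`. `efProofSearchOfCollapse`: under `¬ (P ≠ NP)` (Cook's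
classes, transported to the tree's `Classes.P`/`Nondeterministic.NP` by `p_bool_eq`,
`CookBridges.np_bool_eq`) search-to-decision (`exists_searchFn_of_NP_subset_P`, Arora–Barak
Thm. 2.18) for the `P`-language `{z | chkFn F z = [1]}` yields `g ∈ FP` finding accepted
certificates; `finderFn F g ∈ FP` checks and re-encodes, and computes (`finderFn_encode`) the code
of `proofFn F g φ`, an extended-Frege proof of every tautology `φ` (`sound_chkFn`). Hence
`PolyTimeComputable encode listBool.encode (proofFn F g)` (`PolyTimeComputable.of_encode`), which
is the item. The hypothesis `IsFrege F` of the item is not used.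

HONEST FRAMING: this is the route's glue S1 ("provable now"), a conditional statement under
`P = NP`; it says nothing about whether `P = NP`, nor about the cruxes of the route.

References: S. A. Cook, R. A. Reckhow, *The relative efficiency of propositional proof systems*,
JSL 44 (1979), §1 (Def. 1.5: the class `𝓛` of polynomial-time functions), §2 (Lemma 2.5, Thm. 2.3),
§4 (Def. 4.1: the extension rule); J. Krajíček, *Bounded arithmetic, propositional logic, and
complexity theory* (CUP 1995), Def. 4.5.2; S. Arora, B. Barak, *Computational Complexity* (CUP 2009),
Thm. 2.18 (decision versus search).
-/

set_option linter.dupNamespace false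

namespace Summit.PneNP.PneNP.Theorems.EFProofSearch

open _root_.Computability Literature.Computability.Complexity Literature.Computability.MetaComplexity
open Literature.Barriers.QuantumAdvantage.TQBFEval (varOcc)

/-! ## Completeness: normal-form certificates are accepted and short; the main theorem -/

section Main

open Brick FregeTransl
open Literature.Barriers.QuantumAdvantage.TQBFEval (cwFn cwFn_encode oneBit_cwFn)

/-! ### The certificate of a normal form -/

/-- The items read off a normal-form certificate. -/
theorem itemsOf_certOf (items : List (ℕ × PropForm ℕ)) (P : List (PropForm ℕ)) :
    itemsOf (certOf items P) = items := by
  rw [itemsOf, certOf, fstF_boolPair, decNil_encList, List.map_map]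
  conv_rhs => rw [← List.map_id items]
  refine List.map_congr_left fun it _ => ?_
  obtain ⟨j, ψ⟩ := it
  simp [itemStr, decodeForm_encode]

/-- The lines read off a normal-form certificate. -/
theorem linesOf_certOf (items : List (ℕ × PropForm ℕ)) (P : List (PropForm ℕ)) :
    linesOf (certOf items P) = P := by
  rw [linesOf, certOf, sndF_boolPair, decNil_encList, List.map_map]
  conv_rhs => rw [← List.map_id P]
  exact List.map_congr_left fun χ _ => by simp [decodeForm_encode]

/-- The second fields of the items of a normal-form certificate are code words. -/
theorem certOf_h2 (items : List (ℕ × PropForm ℕ)) (P : List (PropForm ℕ)) :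
    ∀ a ∈ decNil (fstF (certOf items P)), sndF a = encodingPropForm.encode (decodeForm (sndF a)) := by
  intro a ha
  rw [certOf, fstF_boolPair, decNil_encList] at ha
  obtain ⟨it, -, rfl⟩ := List.mem_map.1 ha
  simp [itemStr, decodeForm_encode]

/-- The lines of a normal-form certificate are code words. -/
theorem certOf_h4 (items : List (ℕ × PropForm ℕ)) (P : List (PropForm ℕ)) :
    ∀ b ∈ decNil (sndF (certOf items P)), b = encodingPropForm.encode (decodeForm b) := by
  intro b hb
  rw [certOf, sndF_boolPair, decNil_encList] at hb
  obtain ⟨χ, -, rfl⟩ := List.mem_map.1 hb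
  rw [decodeForm_encode]

/-- **The checker accepts the certificate of a normal form.** -/
theorem chkFn_certOf {F : FregeSystem} {φ : PropForm ℕ} {items : List (ℕ × PropForm ℕ)} {P : List (PropForm ℕ)}
    (hidx : items.map Prod.fst = List.range items.length)
    (hvbE : ∀ it ∈ items, ∀ v ∈ it.2.vars, (encodeNat v).length ≤ (encodingPropForm.encode φ).length + it.1)
    (hinf : ∀ (i : ℕ) (hi : i < P.length),
      F.IsInferred (items.map (extLine (encodingPropForm.encode φ).length) ++ P.take i) P[i])
    (hlast : P.getLast? = some φ) :
    chkFn F (boolPair (encodingPropForm.encode φ) (certOf items P)) = [true] := by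
  set x := encodingPropForm.encode φ with hx
  rw [chkFn_eq_true_iff]
  refine ⟨?_, ?_, ?_, ?_, ?_⟩
  · -- C2
    rw [c2Fn, Function.comp_apply, xAFn_boolPair, allFn_boolPair_eq_true oneBit_eItemFn, decNil_encList]
    intro a ha
    rw [certOf, fstF_boolPair, decNil_encList] at ha
    obtain ⟨it, hit, rfl⟩ := List.mem_map.1 ha
    have ha2 : sndF (itemStr it) = encodingPropForm.encode it.2 := by simp [itemStr]
    rw [eItemFn, andFn_eq_true_iff (oneBit_cwFn.comp _) oneBit_vbFn]
    refine ⟨by simp [itemStr, cwFn_encode], (vbFn_eq_true_iff ha2).2 ?_⟩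
    have : (fstF (itemStr it)).length = it.1 := by simp [itemStr]
    rw [this]
    exact hvbE it hit
  · -- C3
    rw [c3Fn, Function.comp_apply, xAFn_boolPair, chainFn_encList_eq_true oneBit_idxLtFn, certOf, fstF_boolPair,
      decNil_encList, List.isChain_map]
    simp only [idxLtFn_apply, List.cons.injEq, and_true, decide_eq_true_eq]
    have hlen : ∀ it : ℕ × PropForm ℕ, (fstF (itemStr it)).length = it.1 := fun it => by simp [itemStr]
    simp only [hlen]
    haveI : IsTrans (ℕ × PropForm ℕ) (fun a b => a.1 < b.1) := ⟨fun _ _ _ => lt_trans⟩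
    refine List.isChain_iff_pairwise.2 ?_
    have hp : (items.map Prod.fst).Pairwise (· < ·) := by rw [hidx]; exact List.pairwise_lt_range
    exact List.pairwise_map.1 hp
  · -- C4
    rw [c4Fn, Function.comp_apply, xBFn_boolPair, allFn_boolPair_eq_true (oneBit_cwFn.comp _), decNil_encList]
    intro b hb
    rw [certOf, sndF_boolPair, decNil_encList] at hb
    obtain ⟨χ, -, rfl⟩ := List.mem_map.1 hb
    simp [cwFn_encode]
  · -- C5: every line is inferred, so the count matches
    rw [c5Fn, Function.comp_apply, fanoutFn_apply, eqPairFn_boolPair_eq_true]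
    simp only [Function.comp_apply]
    rw [fullFn_eq (certOf_h2 items P) (certOf_h4 items P), eOnlyFn_eq (certOf_h2 items P), extractProof,
      fstF_translFn_encode, fstF_translFn_encode, cntBFn_boolPair, ← List.replicate_add, itemsOf_certOf,
      linesOf_certOf, (length_translForms_unitTable_append F _ _).2.2 hinf]
  · -- C6: the last line
    rw [c6Fn, Function.comp_apply, fanoutFn_apply, eqPairFn_boolPair_eq_true, Function.comp_apply, xBFn_boolPair,
      lastItemFn_boolPair, decNil_encList, fstF_boolPair, certOf, sndF_boolPair, decNil_encList, List.getLast?_map,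
      hlast]
    rfl

/-! ### Length of the certificate -/

/-- The prefix code of a formula all of whose variables have numerals of length `≤ B` has length at
most `(2B + 4) · |ψ|`. -/
theorem length_code_le_of_vars {ψ : PropForm ℕ} {B : ℕ} (hB : ∀ v ∈ ψ.vars, (encodeNat v).length ≤ B) :
    ψ.code.length ≤ (2 * B + 4) * ψ.size := by
  induction ψ with
  | var n =>
    have := hB n (by simp [PropForm.vars])
    simp only [PropForm.code, List.length_cons, length_boolPair, List.length_nil, PropForm.size]
    omega
  | const b => simp [PropForm.code, PropForm.size]
  | neg φ ih =>
    have := ih (fun v hv => hB v (by simpa [PropForm.vars] using hv))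
    simp only [PropForm.code, List.length_cons, PropForm.size]
    nlinarith
  | conj φ₁ φ₂ ih₁ ih₂ =>
    have h₁ := ih₁ (fun v hv => hB v (by simp [PropForm.vars, hv]))
    have h₂ := ih₂ (fun v hv => hB v (by simp [PropForm.vars, hv]))
    simp only [PropForm.code, List.length_cons, List.length_append, PropForm.size]
    nlinarith
  | disj φ₁ φ₂ ih₁ ih₂ =>
    have h₁ := ih₁ (fun v hv => hB v (by simp [PropForm.vars, hv]))
    have h₂ := ih₂ (fun v hv => hB v (by simp [PropForm.vars, hv]))
    simp only [PropForm.code, List.length_cons, List.length_append, PropForm.size]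
    nlinarith

/-- The code word of such a formula has length at most `(2B + 8) · |ψ|`. -/
theorem length_encode_le_of_vars {ψ : PropForm ℕ} {B : ℕ} (hB : ∀ v ∈ ψ.vars, (encodeNat v).length ≤ B) :
    (encodingPropForm.encode ψ).length ≤ (2 * B + 8) * ψ.size := by
  have := length_code_le_of_vars hB
  have hs := ψ.size_pos
  rw [length_encode_propForm]
  nlinarith

/-- **Length of a normal-form certificate**: with `m, |P|, Σ|ψ_j| + proofSize P ≤ S` and all
variables of numeral length `≤ L + S`, the certificate has length `≤ 100 · (L + S + 1)²`. -/
theorem length_certOf_le {L S : ℕ} {items : List (ℕ × PropForm ℕ)} {P : List (PropForm ℕ)}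
    (hidx : ∀ it ∈ items, it.1 ≤ S)
    (hvbE : ∀ it ∈ items, ∀ v ∈ it.2.vars, (encodeNat v).length ≤ L + S)
    (hvbP : ∀ χ ∈ P, ∀ v ∈ χ.vars, (encodeNat v).length ≤ L + S)
    (hsize : (items.map fun it => it.2.size).sum + proofSize P ≤ S)
    (hm : items.length ≤ S) (hP : P.length ≤ S) :
    (certOf items P).length ≤ 100 * (L + S + 1) ^ 2 := by
  -- item strings
  have hA : ∀ it ∈ items, 2 * (itemStr it).length + 2 ≤ (4 * (L + S) + 20) * it.2.size + (4 * S + 6) := by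
    intro it hit
    have h1 := length_encode_le_of_vars (hvbE it hit)
    have h2 := hidx it hit
    rw [itemStr, length_boolPair, List.length_replicate]
    nlinarith
  have hA' : (encList (items.map itemStr)).length ≤
      (4 * (L + S) + 20) * (items.map fun it => it.2.size).sum + (4 * S + 6) * items.length := by
    rw [length_encList, List.map_map]
    calc (items.map ((fun a : List Bool => 2 * a.length + 2) ∘ itemStr)).sum
        ≤ (items.map fun it => (4 * (L + S) + 20) * it.2.size + (4 * S + 6)).sum :=
          List.sum_le_sum fun it hit => hA it hit
      _ = (4 * (L + S) + 20) * (items.map fun it => it.2.size).sum + (4 * S + 6) * items.length := by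
          rw [List.sum_map_add, List.sum_map_mul_left, List.map_const', List.sum_replicate, smul_eq_mul,
            Nat.mul_comm items.length]
  -- line strings
  have hB : ∀ χ ∈ P, 2 * (encodingPropForm.encode χ).length + 2 ≤ (4 * (L + S) + 16) * χ.size + 2 := by
    intro χ hχ
    have h1 := length_encode_le_of_vars (hvbP χ hχ)
    nlinarith
  have hB' : (encList (P.map encodingPropForm.encode)).length ≤ (4 * (L + S) + 16) * proofSize P + 2 * P.length := by
    rw [length_encList, List.map_map, proofSize]
    calc (P.map ((fun a : List Bool => 2 * a.length + 2) ∘ encodingPropForm.encode)).sum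
        ≤ (P.map fun χ => (4 * (L + S) + 16) * χ.size + 2).sum := List.sum_le_sum fun χ hχ => hB χ hχ
      _ = (4 * (L + S) + 16) * (P.map PropForm.size).sum + 2 * P.length := by
          rw [List.sum_map_add, List.sum_map_mul_left, List.map_const', List.sum_replicate, smul_eq_mul,
            Nat.mul_comm P.length]
  rw [certOf, length_boolPair]
  have hsum1 : (items.map fun it => it.2.size).sum ≤ S := by omega
  have hsum2 : proofSize P ≤ S := by omega
  nlinarith [hA', hB', hsum1, hsum2, hm, hP]

/-- **Completeness of the checker.** If extended Frege over `F` is polynomially bounded, there is a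
polynomial `q` such that every tautology `φ` has a certificate `y` of length `≤ q(|encode φ|)`
accepted by the checker. -/
theorem complete_chkFn {F : FregeSystem} (hEF : F.IsEFPolyBounded) :
    ∃ q : Polynomial ℕ, ∀ φ : PropForm ℕ, φ.IsTautology →
      ∃ y : List Bool, y.length ≤ q.eval (encodingPropForm.encode φ).length ∧
        boolPair (encodingPropForm.encode φ) y ∈ {z | chkFn F z = [true]} := by
  obtain ⟨p, hp⟩ := hEF
  refine ⟨100 * (Polynomial.X + p + 1) ^ 2, fun φ hφ => ?_⟩
  obtain ⟨π, hπ, hsz⟩ := hp φ hφ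
  set L := (encodingPropForm.encode φ).length with hL
  obtain ⟨items, P, hidx, hvbE, hvbP, hinf, hlast, hsize, hm, hPl⟩ :=
    exists_normalForm (L := L) hπ (fun v hv => length_encodeNat_lt_length_encode hv)
  -- the size bound in terms of `L`
  have hφL : φ.size ≤ L := by rw [hL, length_encode_propForm]; omega
  have hS : proofSize π ≤ p.eval L := hsz.trans (TM2Iter.eval_mono p hφL)
  set S := p.eval L with hS'
  have hidx' : ∀ it ∈ items, it.1 ≤ S := by
    intro it hit
    have : it.1 ∈ items.map Prod.fst := List.mem_map_of_mem hit
    rw [hidx, List.mem_range] at this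
    omega
  refine ⟨certOf items P, ?_, chkFn_certOf hidx hvbE hinf hlast⟩
  calc (certOf items P).length ≤ 100 * (L + S + 1) ^ 2 :=
        length_certOf_le hidx' (fun it hit v hv => (hvbE it hit v hv).trans (by have := hidx' it hit; omega))
          (fun χ hχ v hv => (hvbP χ hχ v hv).trans (by omega)) (hsize.trans hS) (hm.trans hS) (hPl.trans hS)
    _ = (100 * (Polynomial.X + p + 1) ^ 2 : Polynomial ℕ).eval L := by simp [hS']

/-! ### The main theorem -/

/-- `finderFn F g ∈ FP` for `g ∈ FP`. -/
theorem finderFn_mem_FP (F : FregeSystem) {g : List Bool → List Bool} (hg : g ∈ FP) : finderFn F g ∈ FP :=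
  iteFn_mem_FP (comp_mem_FP (chkFn_mem_FP F) (fanoutFn_mem_FP (PolyTimeComputable.id _) hg))
    (comp_mem_FP fullFn_mem_FP (fanoutFn_mem_FP (PolyTimeComputable.id _) hg)) (const_mem_FP _)

/-- Value of the finder on every string. -/
theorem finderFn_apply (F : FregeSystem) (g : List Bool → List Bool) (x : List Bool) :
    finderFn F g x = if chkFn F (boolPair x (g x)) = [true] then fullFn (boolPair x (g x))
      else encodingPropForm.listBool.encode [] := by
  have h1 : (chkFn F ∘ fanoutFn id g) x = chkFn F (boolPair x (g x)) := by
    rw [Function.comp_apply, fanoutFn_apply]; rfl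
  have h2 : (fullFn ∘ fanoutFn id g) x = fullFn (boolPair x (g x)) := by
    rw [Function.comp_apply, fanoutFn_apply]; rfl
  rw [finderFn, iteFn_of_oneBit ((oneBit_chkFn F).comp (fanoutFn id g)), h1, h2]

/-- The finder computes the code of `proofFn`. -/
theorem finderFn_encode (F : FregeSystem) (g : List Bool → List Bool) (φ : PropForm ℕ) :
    finderFn F g (encodingPropForm.encode φ) = encodingPropForm.listBool.encode (proofFn F g φ) := by
  rw [finderFn_apply, proofFn]
  by_cases h : chkFn F (boolPair (encodingPropForm.encode φ) (g (encodingPropForm.encode φ))) = [true]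
  · rw [if_pos h, if_pos h]
    exact (sound_chkFn h).2
  · rw [if_neg h, if_neg h]

/-- If the check passes, `proofFn` is an extended-Frege proof of `φ`. -/
theorem isEFProofOf_proofFn {F : FregeSystem} {g : List Bool → List Bool} {φ : PropForm ℕ}
    (h : chkFn F (boolPair (encodingPropForm.encode φ) (g (encodingPropForm.encode φ))) = [true]) :
    F.IsEFProofOf (proofFn F g φ) φ := by
  rw [proofFn, if_pos h]
  exact (sound_chkFn h).1

/-- The accepted pairs form a language in `P`. -/
theorem chkLang_mem_P (F : FregeSystem) : {z | chkFn F z = [true]} ∈ Classes.P :=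
  mem_P_of_boolValued (chkFn_mem_FP F) fun z => by
    obtain ⟨b, hb⟩ := oneBit_chkFn F z
    cases b
    · exact Or.inr hb
    · exact Or.inl hb

/-- **`EFProofSearchOfCollapse` (stmt-PneNP-18943, glue S1 of route EfNotPOptimal).** If `P = NP`
then for every Frege rule list `F` whose extended Frege system is polynomially bounded there is a
polynomial-time `f` mapping every tautology `φ` to an extended-Frege proof of `φ` over `F`:
search-to-decision (`exists_searchFn_of_NP_subset_P`, Arora–Barak Thm. 2.18) for the `P`-relation
"`y` is an accepted certificate for `encode φ`" (`chkFn F ∈ FP`), whose short witnesses exist by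
the normal form of EF proofs (`complete_chkFn`) and whose witnesses decode to EF proofs
(`sound_chkFn`); the output is re-encoded by `fullFn ∈ FP`. The hypothesis `IsFrege F` of the
item is not needed. -/
theorem efProofSearchOfCollapse : Summit.PneNP.PneNP.Theses.EfNotPOptimal.EFProofSearchOfCollapse := by
  intro hS F _hF hEF
  -- `¬ (P ≠ NP)` puts certificate-`NP` inside `P` (Cook's classes along the proved model bridges)
  have hNP : Nondeterministic.NP ⊆ Classes.P := fun A hA => by
    by_contra hA'
    exact hS ⟨A, by rw [CookBridges.np_bool_eq]; exact hA, by rw [p_bool_eq]; exact hA'⟩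
  obtain ⟨q, hq⟩ := complete_chkFn hEF
  obtain ⟨g, hg, hspec⟩ := exists_searchFn_of_NP_subset_P hNP (chkLang_mem_P F) q
  refine ⟨proofFn F g, PolyTimeComputable.of_encode (finderFn_mem_FP F hg) encodingPropForm.encode
    (fun _ => rfl) (finderFn_encode F g), fun φ hφ => ?_⟩
  obtain ⟨y, hy, hacc⟩ := hq φ hφ
  exact isEFProofOf_proofFn (hspec (encodingPropForm.encode φ) ⟨y, hy, hacc⟩).2

end Main
end Summit.PneNP.PneNP.Theorems.EFProofSearch
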